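import Literature.AlgebraicGeometry.Motives.AbelianVarietyFundamentalGroup
import Literature.AlgebraicGeometry.Motives.AbelianVarietyQuotientGroup
import Literature.AlgebraicTopology.FundamentalGroup.PowerFactorCovering
import Literature.NumberTheory.DiophantineGeometry.AVIsogenyFlat
import HarnessLib

/-!
# Realizing finite-index subgroups of `π₁(A(ℂ))` by isogenies `A' → A`

For a complex abelian variety `A`, a natural number `n ≥ 1` and a subgroup `K ⊆ π₁(A(ℂ), 1)`
containing all `n`-th powers, there are an abelian variety `A'` over `ℂ`, an isogeny `h : A → A'`
and a homomorphism `r : A' → A` with `r ∘ h = [n]_A`, such that the covering map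
`r(ℂ) : A'(ℂ) → A(ℂ)` has `r_* π₁(A'(ℂ), 1) = K` (`exists_hom_range_mapOfEq_eq`).

Construction (Mumford, *Abelian Varieties*, §7 Thm. 4 and its proof: quotients `X → X/S` by finite
subgroups are isogenies with kernel `S`, and `X/S → X/X_n = X`): `A(ℂ) → A(ℂ)`, `x ↦ xⁿ` is the
normal covering `[n](ℂ)` with deck group `A[n](ℂ)` (`AbelianVarietyFundamentalGroup.lean`) and
monodromy surjection `χ : π₁(A(ℂ), 1) → A[n](ℂ)ᵒᵖ`; put `S := χ(K) ⊆ A[n](ℂ)` (un-opposed), a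
finite subgroup killed by `[n]`; `A' := A/S` is the tree's quotient abelian variety
(`AbelianVariety.quot`, `AbelianVarietyQuotientGroup.lean`, with auxiliary isogeny `q = [n]`), `h` its
quotient isogeny (`quotHom`, kernel `S` on complex points, `comp_quotientMapOver_eq_one_iff`), and
`r : A' → A` the factorization of `[n]` through `h` (`Ker h ⊆ Ker [n]`;
`IsIsogeny.exists_comp_eq_of_kerPoints_le_holds`, the universal property of the quotient). On complex
points `r ∘ h = (x ↦ xⁿ)` with `h` onto and `ker h = S = χ(K)`, so `r_* π₁(A'(ℂ)) = χ⁻¹(χ(K)) = K`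
by the covering-space computation `range_mapOfEq_right_eq_of_ker_eq` (`PowerFactorCovering.lean`,
Hatcher Prop. 1.36–1.40).

This is the step "the subgroup `K ⊇ f_* π₁(C)` of index `2` is the image of `π₁` of a double
covering `J' → J` by an abelian variety" in the topological proof that `(f^P)_* π₁(C(ℂ))` has finite
index in `π₁(J(ℂ))` for the Jacobian `J` of a curve `C` (towards the named fact
`isIso_bettiCohomology_map_abelJacobi`). Everything is proved; there are no new definitions.

## References

* D. Mumford, *Abelian Varieties* (1970), §7 Thm. 4 (p. 72). [MumfordAV1970]
* A. Hatcher, *Algebraic Topology* (2002), §1.3 Prop. 1.36–1.40. [HatcherAT2002]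
-/

noncomputable section

open CategoryTheory AlgebraicGeometry
open Literature.AlgebraicTopology.FundamentalGroup

namespace Literature.AlgebraicGeometry.Motives

namespace AbelianVariety

open scoped MonObj

variable (A : AbelianVariety ℂ)

/-! ### Hypotheses of the quotient construction over `ℂ` -/

/-- Over `ℂ/ℂ` every subgroup of `A(ℂ)` is Galois stable (the only `ℂ`-automorphism of `ℂ` over
`ℂ` is the identity). [folklore] -/
theorem smul_mem_of_algEquiv_self (S : Subgroup (A.Points ℂ)) (σ : ℂ ≃ₐ[ℂ] ℂ) (s : A.Points ℂ)
    (hs : s ∈ S) : σ • s ∈ S := by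
  have hσ : σ = 1 := AlgEquiv.ext fun x => by simpa using σ.commutes x
  rw [hσ, one_smul]
  exact hs

/-- A point of `S ⊆ A[n](ℂ)` is killed by `[n]_A`. [folklore] -/
theorem comp_zsmul_id_eq_one_of_le_torsionPoints {n : ℕ} {S : Subgroup (A.Points ℂ)}
    (hS : S ≤ A.torsionPoints ℂ n) (s : A.Points ℂ) (hs : s ∈ S) :
    s ≫ (((n : ℤ) • 𝟙 A :) ).hom.hom.hom = 1 := by
  have h := hS hs
  rw [mem_torsionPoints_iff] at h
  rw [← AlgPoints.map_apply, map_zsmul_id_apply]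
  exact h

/-- `[n]_A` is finite for `n ≥ 1` (an isogeny in characteristic `0`). [cite: GortzWedhorn2023, Prop. 27.186 and Prop. 27.187] -/
theorem isFinite_toSchemeHom_zsmul_id {n : ℕ} (hn : n ≠ 0) :
    IsFinite (Hom.toSchemeHom ((n : ℤ) • 𝟙 A)) :=
  (isIsogeny_zsmul_id_of_cast_ne_zero (A := A) (n : ℤ) (by exact_mod_cast hn)).2

/-- A subgroup of `A[n](ℂ)`, `n ≥ 1`, is finite. [cite: MumfordAV1970, §6 Application 3 (Proposition p. 64)] -/
theorem finite_of_le_torsionPoints {n : ℕ} (hn : n ≠ 0) {S : Subgroup (A.Points ℂ)}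
    (hS : S ≤ A.torsionPoints ℂ n) : Finite S :=
  haveI := finite_torsionPoints_of_cast_ne_zero A ℂ (n : ℤ) (by exact_mod_cast hn)
  Finite.of_injective (Subgroup.inclusion hS) (Subgroup.inclusion_injective hS)

/-! ### The quotient `A/S`, its isogeny `h` and the factorization `r` of `[n]` -/

section Quotient

variable {n : ℕ} (hn : n ≠ 0) (S : Subgroup (A.Points ℂ)) (hS : S ≤ A.torsionPoints ℂ n)
  [IsAffineHom (Hom.toSchemeHom ((n : ℤ) • 𝟙 A))]

/-- **The kernel of `h : A(ℂ) → (A/S)(ℂ)` is `S`** (Mumford §7 Thm. 4: `Ker(X → X/S) = S`; the tree's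
`comp_quotientMapOver_eq_one_iff` at `Ω = L = ℂ`). [cite: MumfordAV1970, §7 Thm. 4 p. 72] -/
theorem ker_monoidHom_quotHom [Finite S] :
    (IsMonHom.monoidHom (A.quotHom ℂ S (A.smul_mem_of_algEquiv_self S) ((n : ℤ) • 𝟙 A)
        (A.comp_zsmul_id_eq_one_of_le_torsionPoints hS) (A.isFinite_toSchemeHom_zsmul_id hn)).hom.hom.hom
      (specOver ℂ ℂ)).ker = S := by
  ext x
  rw [MonoidHom.mem_ker, IsMonHom.monoidHom_apply, quotHom_hom]
  have h := A.comp_quotientMapOver_eq_one_iff ℂ S (A.smul_mem_of_algEquiv_self S) ((n : ℤ) • 𝟙 A)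
    (A.comp_zsmul_id_eq_one_of_le_torsionPoints hS) (specOver ℂ ℂ).hom (𝟙 _) (Category.id_comp _) x
  have hcomp : ∀ s : A.Points ℂ, (Over.homMk (𝟙 (Spec (CommRingCat.of ℂ))) (Category.id_comp _) :
      Over.mk (specOver ℂ ℂ).hom ⟶ specOver ℂ ℂ) ≫ s = s := fun s => by
    ext : 1
    exact Category.id_comp _
  refine h.trans ⟨?_, fun hx => ⟨⟨x, hx⟩, (hcomp x).symm⟩⟩
  rintro ⟨s, hs⟩
  have hs' : x = (s : A.Points ℂ) := hs.trans (hcomp s)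
  rw [hs']
  exact s.2

/-- **`h : A(ℂ) → (A/S)(ℂ)` is surjective** (the quotient isogeny is surjective, hence surjective on
complex points). [cite: MumfordAV1970, §7 Thm. 4 p. 72] -/
theorem surjective_monoidHom_quotHom [Finite S] :
    Function.Surjective (IsMonHom.monoidHom (A.quotHom ℂ S (A.smul_mem_of_algEquiv_self S)
      ((n : ℤ) • 𝟙 A) (A.comp_zsmul_id_eq_one_of_le_torsionPoints hS)
      (A.isFinite_toSchemeHom_zsmul_id hn)).hom.hom.hom (specOver ℂ ℂ)) := by
  intro y
  haveI : AlgebraicGeometry.Surjective ((A.quotHom ℂ S (A.smul_mem_of_algEquiv_self S)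
      ((n : ℤ) • 𝟙 A) (A.comp_zsmul_id_eq_one_of_le_torsionPoints hS)
      (A.isFinite_toSchemeHom_zsmul_id hn)).hom.hom.hom).left :=
    (inferInstance : AlgebraicGeometry.Surjective (A.quotientMapOver ℂ S
      (A.smul_mem_of_algEquiv_self S) ((n : ℤ) • 𝟙 A)
      (A.comp_zsmul_id_eq_one_of_le_torsionPoints hS)).left)
  obtain ⟨x, hx⟩ := AlgPoints.map_surjective_of_surjective (A.quotHom ℂ S
    (A.smul_mem_of_algEquiv_self S) ((n : ℤ) • 𝟙 A) (A.comp_zsmul_id_eq_one_of_le_torsionPoints hS)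
    (A.isFinite_toSchemeHom_zsmul_id hn)).hom.hom.hom y
  exact ⟨x, hx⟩

/-- **`[n]` factors through `h`**: there is a homomorphism `r : A/S → A` with `h ≫ r = [n]_A`
(`Ker h ⊆ Ker [n]` on `T`-points and the universal property of the quotient isogeny `h`;
Mumford §7 Thm. 4, Görtz–Wedhorn II (27.33)). [cite: MumfordAV1970, §7 Thm. 4 p. 72] -/
theorem exists_quotHom_comp_eq_zsmul_id [Finite S] :
    ∃ r : A.quot ℂ S (A.smul_mem_of_algEquiv_self S) ((n : ℤ) • 𝟙 A)
        (A.comp_zsmul_id_eq_one_of_le_torsionPoints hS) (A.isFinite_toSchemeHom_zsmul_id hn) ⟶ A,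
      A.quotHom ℂ S (A.smul_mem_of_algEquiv_self S) ((n : ℤ) • 𝟙 A)
        (A.comp_zsmul_id_eq_one_of_le_torsionPoints hS) (A.isFinite_toSchemeHom_zsmul_id hn) ≫ r =
      (n : ℤ) • 𝟙 A :=
  IsIsogeny.exists_comp_eq_of_kerPoints_le_holds (A.isIsogeny_quotHom ℂ S _ _ _ _) _ fun _ x hx =>
    (Hom.mem_kerPoints_iff _ _).mpr
      (A.comp_eq_one_of_comp_quotientMapOver_eq_one ℂ S _ _ _ x ((Hom.mem_kerPoints_iff _ _).mp hx))

end Quotient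

/-! ### Realizing `K ⊆ π₁(A(ℂ))` -/

/-- On points, `(f ≫ g)(P) = g(f(P))` for homomorphisms of abelian varieties. [folklore] -/
theorem monoidHom_comp_apply {B C : AbelianVariety ℂ} (f : A ⟶ B) (g : B ⟶ C) (P : A.Points ℂ) :
    IsMonHom.monoidHom (f ≫ g).hom.hom.hom (specOver ℂ ℂ) P =
      IsMonHom.monoidHom g.hom.hom.hom (specOver ℂ ℂ)
        (IsMonHom.monoidHom f.hom.hom.hom (specOver ℂ ℂ) P) := by
  simp only [IsMonHom.monoidHom_apply]
  exact (Category.assoc _ _ _).symm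

/-- On points, `[n]_A(P) = Pⁿ`. [cite: GortzWedhorn2023, (27.35.2)] -/
theorem monoidHom_zsmul_id_apply (n : ℕ) (P : A.Points ℂ) :
    IsMonHom.monoidHom ((n : ℤ) • 𝟙 A :).hom.hom.hom (specOver ℂ ℂ) P = P ^ n := by
  rw [IsMonHom.monoidHom_apply, ← AlgPoints.map_apply, map_zsmul_id_apply, zpow_natCast]

/-- The homomorphism on complex points of a homomorphism of abelian varieties is continuous (strong
topology; `AlgPoints.continuous_map`). [folklore] -/
theorem continuous_monoidHom {B : AbelianVariety ℂ} (f : A ⟶ B) :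
    Continuous (IsMonHom.monoidHom f.hom.hom.hom (specOver ℂ ℂ)) :=
  AlgPoints.continuous_map (L := ℂ) f.hom.hom.hom

/-- **Every subgroup `K ⊆ π₁(A(ℂ), 1)` containing the `n`-th powers (`n ≥ 1`) is the image of `π₁` of
an abelian variety `A'` under a homomorphism `r : A' → A` through which `[n]_A` factors by an
isogeny `h : A → A'`** — namely `A' = A/S` for `S = χ(K) ⊆ A[n](ℂ)`, `χ` the monodromy of the covering
`x ↦ xⁿ` of `A(ℂ)` (Mumford §7 Thm. 4; Hatcher Prop. 1.36–1.40 for `r_* π₁ = χ⁻¹(χ(K)) = K`).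
[cite: MumfordAV1970, §7 Thm. 4 p. 72] -/
theorem exists_hom_range_mapOfEq_eq {n : ℕ} (hn : n ≠ 0)
    (K : Subgroup (FundamentalGroup (A.Points ℂ) (1 : A.Points ℂ)))
    (hK : ∀ p : FundamentalGroup (A.Points ℂ) (1 : A.Points ℂ), p ^ n ∈ K) :
    ∃ (A' : AbelianVariety ℂ) (h : A ⟶ A') (r : A' ⟶ A), IsIsogeny h ∧ h ≫ r = (n : ℤ) • 𝟙 A ∧
      Function.Surjective (IsMonHom.monoidHom h.hom.hom.hom (specOver ℂ ℂ)) ∧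
      (FundamentalGroup.mapOfEq (⟨IsMonHom.monoidHom r.hom.hom.hom (specOver ℂ ℂ),
          A'.continuous_monoidHom r⟩ : C(A'.Points ℂ, A.Points ℂ))
        (map_one (IsMonHom.monoidHom r.hom.hom.hom (specOver ℂ ℂ)))).range = K := by
  -- the covering `x ↦ xⁿ` and its monodromy `χ`
  have hpow := A.pow_surjective n hn
  have hfin := A.finite_ker_powMonoidHom n hn
  set χ := (isQuotientCoveringMap_pow n hpow hfin (G := A.Points ℂ)).fundamentalGroupToMulOpposite
    ⟨1, one_mem_preimage_pow n⟩
  -- `S = χ(K) ⊆ A[n](ℂ)`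
  set S : Subgroup (A.Points ℂ) := ((K.map χ).unop).map (powMonoidHom n : A.Points ℂ →* _).ker.subtype
    with hSdef
  have hS : S ≤ A.torsionPoints ℂ n := by
    rintro _ ⟨y, -, rfl⟩
    rw [← ker_powMonoidHom_eq_torsionPoints]
    exact y.2
  haveI : Finite S := A.finite_of_le_torsionPoints hn hS
  haveI : IsFinite (Hom.toSchemeHom ((n : ℤ) • 𝟙 A)) := A.isFinite_toSchemeHom_zsmul_id hn
  haveI : IsAffineHom (Hom.toSchemeHom ((n : ℤ) • 𝟙 A)) := inferInstance
  obtain ⟨r, hr⟩ := A.exists_quotHom_comp_eq_zsmul_id hn S hS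
  refine ⟨_, _, r, A.isIsogeny_quotHom ℂ S _ _ _ _, hr, A.surjective_monoidHom_quotHom hn S hS, ?_⟩
  refine range_mapOfEq_right_eq_of_ker_eq
    (IsMonHom.monoidHom (A.quotHom ℂ S (A.smul_mem_of_algEquiv_self S) ((n : ℤ) • 𝟙 A)
      (A.comp_zsmul_id_eq_one_of_le_torsionPoints hS) (A.isFinite_toSchemeHom_zsmul_id hn)).hom.hom.hom
      (specOver ℂ ℂ))
    (IsMonHom.monoidHom r.hom.hom.hom (specOver ℂ ℂ)) n (A.continuous_monoidHom _)
    (continuous_monoidHom _ r) (fun x => ?_) (A.surjective_monoidHom_quotHom hn S hS) hpow hfin K hK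
    (A.ker_monoidHom_quotHom hn S hS)
  rw [← monoidHom_comp_apply, hr, monoidHom_zsmul_id_apply]

end AbelianVariety

end Literature.AlgebraicGeometry.Motives

end
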